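import Summits.Ventures.DiscreteObjects.Hadamard.Order25TimesPrime668

/-!
# H(668): an automorphism of order 75 fixes exactly 2 + 2 or exactly 8 + 8 rows and columns (kernel; structure)

Framing: lottery ticket; floor = certified bounds/negative ranges.

Cell pub-namedobj (venture DiscreteObjects), target (H), hadamard gen 19 — HANDOFF-H-g18 item 3a ('induced automorphism of the
fixed Hadamard block').  Let `(π, κ, d, e)` be a signed automorphism of a Hadamard matrix of order `668` whose permutation pair has
order exactly `75` (`π^75 = κ^75 = 1`, `(π^25, κ^25) ≠ (1,1)`, `(π^15, κ^15) ≠ (1,1)`).  Its cube has pair order `25`, so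
(`hadamard668_order25_fixed_eight`, gen 18) `R = Fix π³` and `C = Fix κ³` have `8` elements each, and the `8 × 8` block
`H[R × C]` is a Hadamard matrix of order `8`: distinct rows of `R` are orthogonal on `C` (`(E3)` mod `5` for the cube,
`fixedRows_inner_dvd`: a multiple of `5`, even, in `[−8, 8]`).  The element itself acts on this block with order dividing `3`;
its fixed rows `Fix π ⊆ R` number `n ≡ 8 (mod 3)`, and for `x ≠ x'` in `Fix π` the vanishing inner product over `C` splits into
the part over `Fix κ` and a part over free `3`-cycles of `κ` in `C`, which is divisible by `3`.  So the fixed Gram matrix tools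
(`card_le_card_of_inner_dvd`, `isSquare_pow_of_inner_dvd`, gen 18, at `p = 3`) give `#Fix π = #Fix κ = n` and `n^n` a square mod
`3`; `n ∈ {2, 5, 8}` and `5⁵ = 2^5 ≡ 2 (mod 3)` is not a square:
* **`hadamard668_order75_fixed`**: `#Fix π = #Fix κ ∈ {2, 8}` (and `#Fix π³ = #Fix κ³ = 8`, `#Fix π^15 = #Fix κ^15 = 68`).
This removes the orbit types with `5` fixed rows from the cyclic orbit-type list of order `75` (HANDOFF-H-g18: 17 types);
order `75` itself is NOT excluded.  Structure of a hypothetical object; H(668) untouched.  Ours; no `sorry`.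
-/

namespace Summit.Ventures.DiscreteObjects.Hadamard

open Finset BigOperators Matrix

open Literature.Combinatorics.Designs.GoethalsSeidel (IsHadamardMatrix)

variable {ι : Type*} [Fintype ι] [DecidableEq ι]

/-- `2^5` is not a square mod `3` (so `5` fixed rows are impossible below) -/
lemma not_isSquare_five_pow_five_mod3 : ¬ IsSquare ((((5 : ℕ) : ZMod 3)) ^ 5) := by decide

section order75
variable {H : Matrix ι ι ℤ} {π κ : Equiv.Perm ι} {d e : ι → ℤ}

/-- columns: the fixed columns of the element inside the `8` fixed columns of its cube, the rest of those `8` in free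
`3`-cycles; hence `#Fix κ ≡ 2 (mod 3)` and `#Fix κ ≤ 8` -/
lemma order75_card_fixed_mod3 (hC8 : (univ.filter fun y => (κ ^ 3) y = y).card = 8) :
    (univ.filter fun y => κ y = y).card % 3 = 2 ∧ (univ.filter fun y => κ y = y).card ≤ 8 := by
  have h3 := dvd_card_fixed_pow_sdiff (π := κ) (by norm_num : (3 : ℕ).Prime)
  have hsplit := Finset.card_filter_add_card_filter_not (s := univ.filter fun y => (κ ^ 3) y = y) (fun y => κ y = y)
  rw [Finset.filter_filter, Finset.filter_filter, hC8] at hsplit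
  have e1 : (univ.filter fun y => (κ ^ 3) y = y ∧ κ y = y) = univ.filter fun y => κ y = y := by
    ext y
    simp only [Finset.mem_filter, Finset.mem_univ, true_and]
    exact ⟨fun h => h.2, fun h => ⟨perm_pow_apply_of_fixed κ h 3, h⟩⟩
  rw [e1] at hsplit
  obtain ⟨c, hc⟩ := h3
  have e2 : (univ.filter fun y => (κ ^ 3) y = y ∧ ¬ κ y = y) = univ.filter fun y => (κ ^ 3) y = y ∧ κ y ≠ y := rfl
  rw [e2, hc] at hsplit
  omega

/-- the inner product of two rows fixed by the element, over the `8` columns fixed by its cube, vanishes -/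
lemma order75_block_orth (hH : IsHadamardMatrix H) (haut : IsSignedAut H π κ d e)
    (hκ : κ ^ 75 = 1) (hC8 : (univ.filter fun y => (κ ^ 3) y = y).card = 8)
    {x x' : ι} (hxx' : x ≠ x') (hx : (π ^ 3) x = x) (hx' : (π ^ 3) x' = x') :
    ∑ y ∈ univ.filter (fun y => (κ ^ 3) y = y), H x y * H x' y = 0 := by
  have haut3 := isSignedAut_pow haut 3
  have hκ3 : (κ ^ 3) ^ (5 * 5) = 1 := by rw [← pow_mul]; exact hκ
  have hC : 0 < (univ.filter fun y => (κ ^ 3) y = y).card := by rw [hC8]; norm_num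
  have hdvd := signedAut_fixedRows_inner_dvd hH haut3 (by norm_num : (5 : ℕ).Prime) hκ3 hC x
    (Finset.mem_filter.mpr ⟨Finset.mem_univ _, hx⟩) x' (Finset.mem_filter.mpr ⟨Finset.mem_univ _, hx'⟩) hxx'
  obtain ⟨m, hm, hsum⟩ := sum_pm_eq_card_sub_two_mul (univ.filter fun y => (κ ^ 3) y = y) (fun y => H x y * H x' y)
    (fun y _ => by rcases hH.1 x y with h1 | h1 <;> rcases hH.1 x' y with h2 | h2 <;> simp [h1, h2])
  rw [hsum] at hdvd ⊢
  rw [hC8] at hm hdvd ⊢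
  obtain ⟨c, hc⟩ := hdvd
  push_cast at hc ⊢
  omega

/-- for two rows fixed by the element, the inner product over the columns fixed by the element is divisible by `3` -/
lemma order75_fixed_inner_dvd3 (hH : IsHadamardMatrix H) (haut : IsSignedAut H π κ d e)
    (hκ : κ ^ 75 = 1) (hC8 : (univ.filter fun y => (κ ^ 3) y = y).card = 8) :
    ∀ x ∈ univ.filter (fun i => π i = i), ∀ x' ∈ univ.filter (fun i => π i = i), x ≠ x' →
      (3 : ℤ) ∣ ∑ y ∈ univ.filter (fun y => κ y = y), H x y * H x' y := by
  intro x hx x' hx' hxx'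
  simp only [Finset.mem_filter, Finset.mem_univ, true_and] at hx hx'
  have h0 := order75_block_orth hH haut hκ hC8 hxx' (perm_pow_apply_of_fixed π hx 3) (perm_pow_apply_of_fixed π hx' 3)
  -- split the block sum: Fix κ and the free 3-cycles inside Fix κ³
  rw [← Finset.sum_filter_add_sum_filter_not _ (fun y => κ y = y), Finset.filter_filter, Finset.filter_filter] at h0
  have e1 : (univ.filter fun y => (κ ^ 3) y = y ∧ κ y = y) = univ.filter fun y => κ y = y := by
    ext y
    simp only [Finset.mem_filter, Finset.mem_univ, true_and]
    exact ⟨fun h => h.2, fun h => ⟨perm_pow_apply_of_fixed κ h 3, h⟩⟩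
  rw [e1] at h0
  -- the second part is divisible by 3
  set Y := univ.filter fun y => (κ ^ 3) y = y ∧ ¬ κ y = y with hY
  have hdd : d x * d x' = 1 := fixedRows_sign_eq_odd hH haut (by decide : Odd 75) hκ hx hx' x
  have hg : ∀ y, H x (κ y) * H x' (κ y) = H x y * H x' y := by
    intro y
    have h1 := haut.2.2 x y
    have h2 := haut.2.2 x' y
    rw [hx] at h1
    rw [hx'] at h2
    rw [h1, h2]
    have he : e y * e y = 1 := pm_mul_self (haut.2.1 y)
    calc d x * e y * H x y * (d x' * e y * H x' y) = (d x * d x') * (e y * e y) * (H x y * H x' y) := by ring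
      _ = H x y * H x' y := by rw [hdd, he]; ring
  have hstab : ∀ y ∈ Y, κ y ∈ Y := by
    intro y hy
    rw [hY, Finset.mem_filter] at hy ⊢
    refine ⟨Finset.mem_univ _, ?_, fun h => hy.2.2 (κ.injective h)⟩
    rw [← Equiv.Perm.mul_apply, ← pow_succ, pow_succ', Equiv.Perm.mul_apply, hy.2.1]
  have hper : ∀ y ∈ Y, (κ ^ 3) y = y := fun y hy => (Finset.mem_filter.mp hy).2.1
  have hfree : ∀ y ∈ Y, ∀ k, 0 < k → k < 3 → (κ ^ k) y ≠ y := by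
    intro y hy
    have hy' := (Finset.mem_filter.mp hy).2
    exact free_of_fixed_prime_pow κ (by norm_num : (3 : ℕ).Prime) hy'.1 hy'.2
  obtain ⟨T, -, -, hT⟩ := exists_orbit_reps κ (by norm_num : 0 < 3) Y.card Y le_rfl hstab hper hfree
  have h3 : (3 : ℤ) ∣ ∑ y ∈ Y, H x y * H x' y := ⟨_, by rw [hT (fun y => H x y * H x' y) hg]; rfl⟩
  have e : ∑ y ∈ univ.filter (fun y => κ y = y), H x y * H x' y = -∑ y ∈ Y, H x y * H x' y := by linarith
  rw [e]
  exact (dvd_neg).mpr h3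

/-- columns and rows together: `#Fix π = #Fix κ ∈ {2, 8}` -/
lemma order75_fixed_aux (hH : IsHadamardMatrix H) (hι : Fintype.card ι = 668) (haut : IsSignedAut H π κ d e)
    (hπ : π ^ 75 = 1) (hκ : κ ^ 75 = 1) (h15 : π ^ 15 ≠ 1 ∨ κ ^ 15 ≠ 1) :
    (univ.filter fun i => π i = i).card = (univ.filter fun j => κ j = j).card ∧
    ((univ.filter fun j => κ j = j).card = 2 ∨ (univ.filter fun j => κ j = j).card = 8) ∧
    (univ.filter fun i => (π ^ 3) i = i).card = 8 ∧ (univ.filter fun j => (κ ^ 3) j = j).card = 8 ∧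
    (univ.filter fun i => (π ^ 15) i = i).card = 68 ∧ (univ.filter fun j => (κ ^ 15) j = j).card = 68 := by
  have hcard : (Fintype.card ι : ℤ) ≠ 0 := by rw [hι]; norm_num
  -- the cube has pair order 25
  have hπ3 : (π ^ 3) ^ 25 = 1 := by rw [← pow_mul]; exact hπ
  have hκ3 : (κ ^ 3) ^ 25 = 1 := by rw [← pow_mul]; exact hκ
  have hne3 : (π ^ 3) ^ 5 ≠ 1 ∨ (κ ^ 3) ^ 5 ≠ 1 := by rw [← pow_mul, ← pow_mul]; exact h15
  obtain ⟨hR8, hC8, hR68, hC68⟩ := hadamard668_order25_fixed_eight hH hι (π ^ 3) (κ ^ 3) _ _ (isSignedAut_pow haut 3)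
    hπ3 hκ3 hne3
  rw [← pow_mul] at hR68 hC68
  -- the fixed Gram matrix at p = 3
  have hHt : IsHadamardMatrix Hᵀ := isHadamard_transpose hH hcard
  have hautT : IsSignedAut Hᵀ κ π e d := isSignedAut_transpose haut
  have hrows := order75_fixed_inner_dvd3 hH haut hκ hC8
  have hcols := order75_fixed_inner_dvd3 hHt hautT hπ hR8
  obtain ⟨hCmod, hCle⟩ := order75_card_fixed_mod3 (κ := κ) hC8
  obtain ⟨hRmod, hRle⟩ := order75_card_fixed_mod3 (κ := π) hR8
  have hC3 : ¬ 3 ∣ (univ.filter fun j => κ j = j).card := by omega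
  have hR3 : ¬ 3 ∣ (univ.filter fun i => π i = i).card := by omega
  have hpmR : ∀ x ∈ univ.filter (fun i => π i = i), ∀ y ∈ univ.filter (fun j => κ j = j),
      H x y = 1 ∨ H x y = -1 := fun x _ y _ => hH.1 x y
  have hpmC : ∀ y ∈ univ.filter (fun j => κ j = j), ∀ x ∈ univ.filter (fun i => π i = i),
      Hᵀ y x = 1 ∨ Hᵀ y x = -1 := fun y _ x _ => hH.1 x y
  have h1 := card_le_card_of_inner_dvd (by norm_num : (3 : ℕ).Prime) (fun x y => H x y) _ _ hpmR hrows hC3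
  have h2 := card_le_card_of_inner_dvd (by norm_num : (3 : ℕ).Prime) (fun y x => Hᵀ y x) _ _ hpmC hcols hR3
  have heq : (univ.filter fun i => π i = i).card = (univ.filter fun j => κ j = j).card := le_antisymm h1 h2
  have hsq := isSquare_pow_of_inner_dvd (p := 3) (fun x y => H x y) _ _ hpmR hrows heq
  rw [heq] at hsq
  refine ⟨heq, ?_, hR8, hC8, by simpa using hR68, by simpa using hC68⟩
  -- n ∈ {2, 5, 8} and 5 is not possible
  have hn : (univ.filter fun j => κ j = j).card = 2 ∨ (univ.filter fun j => κ j = j).card = 5 ∨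
      (univ.filter fun j => κ j = j).card = 8 := by omega
  rcases hn with h | h | h
  · exact Or.inl h
  · rw [h] at hsq; exact absurd hsq not_isSquare_five_pow_five_mod3
  · exact Or.inr h

/-- **Order 75: the element fixes exactly `2 + 2` or exactly `8 + 8`.**  For a signed automorphism `(π, κ, d, e)` of a Hadamard
matrix of order `668` whose permutation pair has order exactly `75` (`π^75 = κ^75 = 1`, `(π^25, κ^25) ≠ (1,1)`,
`(π^15, κ^15) ≠ (1,1)`): `#Fix π = #Fix κ ∈ {2, 8}`; its cube fixes exactly `8 + 8` and its 15th power exactly `68 + 68`.  [The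
hypothesis `(π^25, κ^25) ≠ (1,1)` is not used: the statement holds for pair orders `25` and `75` alike, order `25` giving `8`.]
Structure only — order `75` is not excluded. -/
theorem hadamard668_order75_fixed (hH : IsHadamardMatrix H) (hι : Fintype.card ι = 668)
    (π κ : Equiv.Perm ι) (d e : ι → ℤ) (haut : IsSignedAut H π κ d e)
    (hπ : π ^ 75 = 1) (hκ : κ ^ 75 = 1) (h15 : π ^ 15 ≠ 1 ∨ κ ^ 15 ≠ 1) :
    (((univ.filter fun i => π i = i).card = 2 ∧ (univ.filter fun j => κ j = j).card = 2) ∨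
     ((univ.filter fun i => π i = i).card = 8 ∧ (univ.filter fun j => κ j = j).card = 8)) ∧
    (univ.filter fun i => (π ^ 3) i = i).card = 8 ∧ (univ.filter fun j => (κ ^ 3) j = j).card = 8 ∧
    (univ.filter fun i => (π ^ 15) i = i).card = 68 ∧ (univ.filter fun j => (κ ^ 15) j = j).card = 68 := by
  obtain ⟨heq, h28, hR8, hC8, hR68, hC68⟩ := order75_fixed_aux hH hι haut hπ hκ h15
  refine ⟨?_, hR8, hC8, hR68, hC68⟩
  rcases h28 with h | h
  · exact Or.inl ⟨by rw [heq, h], h⟩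
  · exact Or.inr ⟨by rw [heq, h], h⟩

/-- **Order form.**  If `75` divides the order of the permutation pair of a signed automorphism of an H(668), a suitable power
`(π', κ')` of pair order `75` fixes exactly `2 + 2` or `8 + 8` rows and columns (never `5 + 5`). -/
theorem hadamard668_orderOf_dvd_75_fixed (hH : IsHadamardMatrix H) (hι : Fintype.card ι = 668)
    (π κ : Equiv.Perm ι) (d e : ι → ℤ) (haut : IsSignedAut H π κ d e)
    (hdvd : 75 ∣ orderOf ((π, κ) : Equiv.Perm ι × Equiv.Perm ι)) :
    ∃ k : ℕ, orderOf ((π ^ k, κ ^ k) : Equiv.Perm ι × Equiv.Perm ι) = 75 ∧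
      (((univ.filter fun i => (π ^ k) i = i).card = 2 ∧ (univ.filter fun j => (κ ^ k) j = j).card = 2) ∨
       ((univ.filter fun i => (π ^ k) i = i).card = 8 ∧ (univ.filter fun j => (κ ^ k) j = j).card = 8)) := by
  set x : Equiv.Perm ι × Equiv.Perm ι := (π, κ) with hx
  have hx0 : orderOf x ≠ 0 := (orderOf_pos x).ne'
  set k := orderOf x / 75 with hk
  have hord : orderOf (x ^ k) = 75 := orderOf_pow_orderOf_div hx0 hdvd
  have hxk : x ^ k = ((π ^ k, κ ^ k) : Equiv.Perm ι × Equiv.Perm ι) := by rw [hx, Prod.pow_mk]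
  rw [hxk] at hord
  obtain ⟨h1, h2, h3⟩ := pow_data_of_orderOf hord (a := 15) (by norm_num) (by norm_num)
  exact ⟨k, hord, (hadamard668_order75_fixed hH hι (π ^ k) (κ ^ k) _ _ (isSignedAut_pow haut k) h1 h2 h3).1⟩

end order75

end Summit.Ventures.DiscreteObjects.Hadamard
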